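import Summits.CriticalPhenomena.PercolationContinuityZ3.Theorems.PercNearOneGluingNoHeavyPcintChainMemStep
import Summits.CriticalPhenomena.PercolationContinuityZ3.Theorems.PercNearOneGluingNoHeavyPcintChordMemSym
import HarnessLib

/-!
# PCINT lane, reduced-state B3c certificates: lattice symmetry and table certificates (bond, chain bookkeeping)

Cell `prim-pcint` (PAPER-2 track (iii): certified intervals for `p_c(ℤ^d)`), seat `prim-pcint-2` (gen 4); support file
(`--supports stmt-CriticalPhenomena-4575`).  Does NOT build on p205010.  Companion of `…PcintChainMem*` (the B3c automaton
`bchainMemAut τ kc` on dangerous-set states); twin of `…PcintChordMemSym`, whose `bchord_smul`, `bcorner_smul`, `smulSite_zero` are reused.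

* EQUIVARIANCE under the hyperoctahedral group: `bcinc_smul`, `clinked_smul_iff`, `cdetSite_smul_iff`, `bcbonus_smul_iff`, `cdetSet_smul`,
  `cdet_smul`, `bcwt_smul`, hence `total_bchainMemAut_smul`.
* TABLE CERTIFICATES: `bctableAut`, `total_bctableAut_eq`, `total_bchainMemAut_le_of_table`, and
  `le_criticalProb_zd_of_chainMemTable : … → p ≤ p_c^bond(ℤ^d)`.
-/

noncomputable section

namespace Summit.CriticalPhenomena.PercolationContinuityZ3.Theorems.Pcint

open Finset Literature.Probability.Percolation Literature.Probability.LatticeModels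

/-! ### Lattice symmetries: equivariance of the B3c automaton, invariance of totals -/

section SymB3c

variable {d : ℕ}

/-- The remembered incidences are equivariant. [folklore] -/
theorem bcinc_smul (g : SPerm d) (S : MState d) (w : Site d) :
    bcinc (smulState g S) (smulSite g w) = (bcinc S w).image fun q => (smulSite g q.1, q.2) := by
  ext q
  rw [bcinc, bcinc, mem_filter, mem_image, mem_smulState]
  constructor
  · rintro ⟨⟨r, hr, hqr⟩, hadj⟩
    refine ⟨(r, q.2), mem_filter.2 ⟨hr, (adj_smulSite_iff g _ _).1 (by rw [← hqr]; exact hadj)⟩, ?_⟩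
    rcases q with ⟨q1, q2⟩
    simp only at hqr
    rw [hqr]
  · rintro ⟨q', hq', rfl⟩
    obtain ⟨hq'S, hadj⟩ := mem_filter.1 hq'
    exact ⟨⟨q'.1, by simpa using hq'S, rfl⟩, (adj_smulSite_iff g _ _).2 hadj⟩

/-- The pair map of a symmetry is injective (local copy). [folklore] -/
private theorem bsmulPair_injective (g : SPerm d) : Function.Injective fun q : Site d × ℕ => (smulSite g q.1, q.2) := by
  rintro ⟨x, i⟩ ⟨y, j⟩ h
  simp only [Prod.mk.injEq] at h
  exact Prod.ext (smulSite_injective g h.1) h.2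

/-- `clinked` is invariant. [folklore] -/
theorem clinked_smul_iff (kc : ℕ) (g : SPerm d) (S : MState d) (w : Site d) :
    clinked kc (smulState g S) (smulSite g w) ↔ clinked kc S w := by
  unfold clinked
  rw [bcinc_smul]
  constructor
  · rintro ⟨q, hq, h⟩
    obtain ⟨q', hq', rfl⟩ := mem_image.1 hq
    exact ⟨q', hq', h⟩
  · rintro ⟨q, hq, h⟩
    exact ⟨(smulSite g q.1, q.2), mem_image.2 ⟨q, hq, rfl⟩, h⟩

/-- `cdetSite` is invariant. [folklore] -/
theorem cdetSite_smul_iff (g : SPerm d) (S : MState d) (w : Site d) :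
    cdetSite (smulState g S) (smulSite g w) ↔ cdetSite S w := by
  unfold cdetSite
  rw [bcinc_smul]
  constructor
  · rintro ⟨q, hq, h⟩
    obtain ⟨q', hq', rfl⟩ := mem_image.1 hq
    exact ⟨q', hq', h⟩
  · rintro ⟨q, hq, h⟩
    exact ⟨(smulSite g q.1, q.2), mem_image.2 ⟨q, hq, rfl⟩, h⟩

/-- `bcbonus` is invariant. [folklore] -/
theorem bcbonus_smul_iff (τ kc : ℕ) (g : SPerm d) (S : MState d) (w : Site d) :
    bcbonus τ kc (smulState g S) (smulSite g w) ↔ bcbonus τ kc S w := by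
  unfold bcbonus
  rw [bcinc_smul]
  constructor
  · rintro ⟨q₁, hq₁, h1, h2, h3⟩
    obtain ⟨q₁', hq₁', rfl⟩ := mem_image.1 hq₁
    refine ⟨q₁', hq₁', h1, h2, fun q hq hne => ?_⟩
    exact h3 (smulSite g q.1, q.2) (mem_image.2 ⟨q, hq, rfl⟩) (fun h => hne (bsmulPair_injective g h))
  · rintro ⟨q₁, hq₁, h1, h2, h3⟩
    refine ⟨(smulSite g q₁.1, q₁.2), mem_image.2 ⟨q₁, hq₁, rfl⟩, h1, h2, fun q hq hne => ?_⟩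
    obtain ⟨q', hq', rfl⟩ := mem_image.1 hq
    exact h3 q' hq' (fun h => hne (by rw [h]))

/-- **The det-paying set is equivariant.** [folklore] -/
theorem cdetSet_smul (kc : ℕ) (g : SPerm d) (S : MState d) (a : Fin d × Bool) :
    cdetSet kc (smulState g S) (smulLetter g a) = (cdetSet kc S a).image (smulSite g) := by
  classical
  ext w
  rw [cdetSet, cdetSet, mem_filter, mem_image, stepVec_smulLetter, nbrSites_smulSite, mem_image]
  constructor
  · rintro ⟨⟨w', hw', rfl⟩, hw0, hnot, hdet, hlink⟩
    refine ⟨w', mem_filter.2 ⟨hw', fun h => hw0 (by rw [h, smulSite_zero]), fun q' hq' hq'w => ?_,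
      (cdetSite_smul_iff g S w').1 hdet, (clinked_smul_iff kc g S w').1 hlink⟩, rfl⟩
    exact hnot (smulSite g q'.1, q'.2) ((mem_smulState g S _).2 ⟨q'.1, by simpa using hq', rfl⟩) (by rw [hq'w])
  · rintro ⟨w', hw', rfl⟩
    obtain ⟨hw'n, hw0, hnot, hdet, hlink⟩ := mem_filter.1 hw'
    refine ⟨⟨w', hw'n, rfl⟩, fun h => hw0 (smulSite_injective g (by rw [h, smulSite_zero])), fun q' hq' hq'w => ?_,
      (cdetSite_smul_iff g S w').2 hdet, (clinked_smul_iff kc g S w').2 hlink⟩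
    obtain ⟨r, hr, hqr⟩ := (mem_smulState g S q').1 hq'
    exact hnot (r, q'.2) hr (smulSite_injective g (by rw [← hqr, hq'w]))

/-- **The number of deterministic units is invariant.** [folklore] -/
theorem cdet_smul (τ kc : ℕ) (g : SPerm d) (S : MState d) (a : Fin d × Bool) :
    cdet τ kc (smulState g S) (smulLetter g a) = cdet τ kc S a := by
  classical
  unfold cdet
  rw [cdetSet_smul, card_image_of_injective _ (smulSite_injective g), filter_image,
    card_image_of_injective _ (smulSite_injective g)]
  congr 2
  ext w
  simp only [mem_filter, bcbonus_smul_iff]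

/-- **The step factor is invariant.** [folklore] -/
theorem bcwt_smul (cr sb κb : ℝ) (τ kc : ℕ) (g : SPerm d) (S : MState d) (a : Fin d × Bool) :
    bcwt cr sb κb τ kc (smulState g S) (smulLetter g a) = bcwt cr sb κb τ kc S a := by
  unfold bcwt; rw [bchord_smul, cdet_smul, bcorner_smul]

/-- Row sums of `bchainMemAut` against an invariant function are invariant. [folklore] -/
theorem stepSum_bchainMemAut_smul {τ kc : ℕ} {p cr sb κb : ℝ} (hp : 0 ≤ p) (hcr : 0 ≤ cr) (hsb : 0 ≤ sb) (hκb : 0 ≤ κb)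
    (g : SPerm d) {f : MState d → ℝ} (hf : ∀ T, f (smulState g T) = f T) (S : MState d) :
    (bchainMemAut τ kc p cr sb κb hp hcr hsb hκb).stepSum f (smulState g S) =
      (bchainMemAut τ kc p cr sb κb hp hcr hsb hκb).stepSum f S := by
  unfold WAut.stepSum
  rw [← Equiv.sum_comp (letterEquiv g)]
  refine Finset.sum_congr rfl fun a _ => ?_
  have h1 : (bchainMemAut τ kc p cr sb κb hp hcr hsb hκb).step (smulState g S) (letterEquiv g a) =
      ((bchainMemAut τ kc p cr sb κb hp hcr hsb hκb).step S a).map (smulState g) := mstep_smul τ g S a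
  have h2 : (bchainMemAut τ kc p cr sb κb hp hcr hsb hκb).wt (smulState g S) (letterEquiv g a) =
      (bchainMemAut τ kc p cr sb κb hp hcr hsb hκb).wt S a := by
    show p * bcwt cr sb κb τ kc (smulState g S) (smulLetter g a) = p * bcwt cr sb κb τ kc S a
    rw [bcwt_smul]
  rw [h1, h2]
  cases (bchainMemAut τ kc p cr sb κb hp hcr hsb hκb).step S a with
  | none => rfl
  | some T => simp only [Option.map_some, hf]

/-- **Totals of the B3c automaton are invariant under lattice symmetries.** [folklore] -/
theorem total_bchainMemAut_smul {τ kc : ℕ} {p cr sb κb : ℝ} (hp : 0 ≤ p) (hcr : 0 ≤ cr) (hsb : 0 ≤ sb) (hκb : 0 ≤ κb)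
    (g : SPerm d) : ∀ (n : ℕ) (S : MState d),
      (bchainMemAut τ kc p cr sb κb hp hcr hsb hκb).total n (smulState g S) =
        (bchainMemAut τ kc p cr sb κb hp hcr hsb hκb).total n S := by
  intro n
  induction n with
  | zero => intro S; rw [WAut.total_zero, WAut.total_zero]
  | succ n ih =>
    intro S
    rw [WAut.total_succ, WAut.total_succ]
    exact stepSum_bchainMemAut_smul hp hcr hsb hκb g (fun T => ih T) S

end SymB3c

/-! ### Table certificates modulo symmetry: a finite index automaton simulating `bchainMemAut` -/

section Table

variable {d N : ℕ}

/-- The INDEX AUTOMATON of a bond table: states are row indices, transitions are read off the table, weights are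
recomputed from the row's state. [folklore] -/
def bctableAut (τ kc : ℕ) (p cr sb κb : ℝ) (hp : 0 ≤ p) (hcr : 0 ≤ cr) (hsb : 0 ≤ sb) (hκb : 0 ≤ κb)
    (R : Fin N → MState d) (sc : Fin N → Fin d × Bool → Option (Fin N × SPerm d)) : WAut (Fin N) (Fin d × Bool) where
  step i a := (sc i a).map Prod.fst
  wt i a := (bchainMemAut τ kc p cr sb κb hp hcr hsb hκb).wt (R i) a
  wt_nonneg i a := (bchainMemAut τ kc p cr sb κb hp hcr hsb hκb).wt_nonneg (R i) a

/-- **Simulation**: the index automaton of a table in simulation with `bchainMemAut` has the same totals. [folklore] -/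
theorem total_bctableAut_eq {τ kc : ℕ} {p cr sb κb : ℝ} (hp : 0 ≤ p) (hcr : 0 ≤ cr) (hsb : 0 ≤ sb) (hκb : 0 ≤ κb)
    (R : Fin N → MState d) (sc : Fin N → Fin d × Bool → Option (Fin N × SPerm d))
    (hsim : ∀ i a, simRel R (mstep τ (R i) a) (sc i a) = true) :
    ∀ (n : ℕ) (i : Fin N), (bctableAut τ kc p cr sb κb hp hcr hsb hκb R sc).total n i =
      (bchainMemAut τ kc p cr sb κb hp hcr hsb hκb).total n (R i) := by
  intro n
  induction n with
  | zero => intro i; rw [WAut.total_zero, WAut.total_zero]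
  | succ n ih =>
    intro i
    rw [WAut.total_succ, WAut.total_succ]
    unfold WAut.stepSum
    refine Finset.sum_congr rfl fun a _ => ?_
    have h := hsim i a
    have e1 : (bctableAut τ kc p cr sb κb hp hcr hsb hκb R sc).step i a = (sc i a).map Prod.fst := rfl
    have e2 : (bchainMemAut τ kc p cr sb κb hp hcr hsb hκb).step (R i) a = mstep τ (R i) a := rfl
    rw [e1, e2]
    revert h
    generalize mstep τ (R i) a = oT
    generalize sc i a = oJ
    intro h
    cases oT with
    | none =>
      cases oJ with
      | none => rfl
      | some jg => exact absurd h (by simp [simRel])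
    | some T =>
      cases oJ with
      | none => exact absurd h (by simp [simRel])
      | some jg =>
        have hT : T = smulState jg.2 (R jg.1) := by simpa [simRel] using h
        simp only [Option.map_some]
        rw [ih jg.1, hT, total_bchainMemAut_smul]
        rfl

/-- **Table certificate ⇒ geometric bound on the totals of `bchainMemAut`.**  If the rows carry states `R i`, positive
weights `V i ≥ 1`, successor data in simulation with `mstep`, and satisfy the Collatz–Wielandt inequalities
`Σ_a p·bcwt(R i,a)·V(succ) ≤ λ V i`, then `total n (R i) ≤ λⁿ V i` for every row. [folklore] -/
theorem total_bchainMemAut_le_of_table {τ kc : ℕ} {p cr sb κb lam : ℝ} (hp : 0 ≤ p) (hcr : 0 ≤ cr) (hsb : 0 ≤ sb)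
    (hκb : 0 ≤ κb) (hlam : 0 ≤ lam) (R : Fin N → MState d) (sc : Fin N → Fin d × Bool → Option (Fin N × SPerm d))
    (V : Fin N → ℝ) (hV : ∀ i, 1 ≤ V i) (hsim : ∀ i a, simRel R (mstep τ (R i) a) (sc i a) = true)
    (hcw : ∀ i, (∑ a : Fin d × Bool, match sc i a with
      | none => 0
      | some jg => p * bcwt cr sb κb τ kc (R i) a * V jg.1) ≤ lam * V i) (n : ℕ) (i : Fin N) :
    (bchainMemAut τ kc p cr sb κb hp hcr hsb hκb).total n (R i) ≤ lam ^ n * V i := by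
  rw [← total_bctableAut_eq hp hcr hsb hκb R sc hsim n i]
  have hcw' : ∀ i, (bctableAut τ kc p cr sb κb hp hcr hsb hκb R sc).stepSum V i ≤ lam * V i := fun i => by
    refine le_of_eq_of_le ?_ (hcw i)
    unfold WAut.stepSum
    refine Finset.sum_congr rfl fun a _ => ?_
    have e1 : (bctableAut τ kc p cr sb κb hp hcr hsb hκb R sc).step i a = (sc i a).map Prod.fst := rfl
    rw [e1]
    cases sc i a with
    | none => rfl
    | some jg => rfl
  have := (bctableAut τ kc p cr sb κb hp hcr hsb hκb R sc).total_le_of_cw one_pos hV hlam hcw' n i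
  rwa [div_one] at this

/-- **Reduced-state B3c certificate (table form) ⇒ `p ≤ p_c^bond(ℤ^d)`.**  The row `i₀` with the empty state gives the bound
on the totals from `∅` needed by `le_criticalProb_zd_of_chainMem_total`.  Constants: `p ≤ 1/2`, `0 < s̄ ≤ 1` with `s̄² ≥ 1 - p²`,
`(1+s̄²)/2 ≤ κ̄`, refund `r ≥ 0` with `s̄·r ≥ 1` and `(1-p)·r² ≤ 1` (chord factor `cr = (1-p)·r²`), `kc ≥ 2`, `kc + 4 ≤ τ`. [folklore] -/
theorem le_criticalProb_zd_of_chainMemTable [NeZero d] {τ kc : ℕ} (hτ : kc + 4 ≤ τ) (hkc : 2 ≤ kc) (p : unitInterval)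
    {sb κb r lam : ℝ} (hp : (p : ℝ) ≤ 1 / 2) (hs0 : 0 < sb) (hsb1 : sb ≤ 1) (hκb : (1 + sb ^ 2) / 2 ≤ κb)
    (hps : 1 - (p : ℝ) ^ 2 ≤ sb ^ 2) (hr0 : 0 ≤ r) (hsr : 1 ≤ sb * r) (hpr : (1 - (p : ℝ)) * (r * r) ≤ 1)
    (hlam0 : 0 ≤ lam) (hlam1 : lam < 1)
    (R : Fin N → MState d) (sc : Fin N → Fin d × Bool → Option (Fin N × SPerm d)) (V : Fin N → ℝ)
    (i₀ : Fin N) (h0 : R i₀ = ∅) (hV : ∀ i, 1 ≤ V i) (hsim : ∀ i a, simRel R (mstep τ (R i) a) (sc i a) = true)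
    (hcw : ∀ i, (∑ a : Fin d × Bool, match sc i a with
      | none => 0
      | some jg => (p : ℝ) * bcwt ((1 - p) * (r * r)) sb κb τ kc (R i) a * V jg.1) ≤ lam * V i) :
    (p : ℝ) ≤ criticalProb (zdGraph d) 0 := by
  refine le_criticalProb_zd_of_chainMem_total hτ hkc p hp hs0 le_rfl hsb1 hκb hps hr0 hsr hpr hlam0 hlam1 (C := V i₀)
    fun n => ?_
  have h := total_bchainMemAut_le_of_table p.2.1 (mul_nonneg (sub_nonneg.2 p.2.2) (mul_nonneg hr0 hr0)) hs0.le (by nlinarith)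
    hlam0 R sc V hV hsim hcw n i₀
  rw [h0] at h
  exact h.trans_eq (mul_comm _ _)

end Table

end Summit.CriticalPhenomena.PercolationContinuityZ3.Theorems.Pcint
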